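import Literature.MathematicalPhysics.QuantumLattice.DWaveSourceEnergyDensityEnsembles
import Literature.MathematicalPhysics.QuantumLattice.DWaveSourceEnergyDensityTPrimeTransport
import Literature.MathematicalPhysics.QuantumLattice.HubbardTTPrimeKinematicRowsAllFillings
import Literature.MathematicalPhysics.QuantumLattice.HubbardTTPrimeTPPFillingTransport
import Literature.MathematicalPhysics.QuantumLattice.HubbardTTPrimeTPPInteraction
import HarnessLib

/-!
# Transport of the sourced energy density along the third-neighbour hopping `t''` (object M of a
# one-band box): the `16/π²` seam at EVERY source, and the variational ceiling on the `d`-wave pair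
# amplitude of object M from ONE certified object-E pair

Topic `Literature/MathematicalPhysics/QuantumLattice` (namespace = path; family `hubbard`). Sequel of
`DWaveSourceEnergyDensityTPrimeTransport.lean` (the `t'` axis of the pair-sourced `t–t'` model) in the one
coupling direction the downfolded material boxes carry and the certified anchors do not: the axial range-2
("third-neighbour") hopping `t''` (Pavarini et al. 2001). Typed by the hubbard-fast planner seat p1
(g15) for hubbard-downfold-mod-1's ORDER-word seam (cell pub/hubbard-fast, INBOX 2026-08-27T00:42Z) and
landed by the cell's literature seat (hubbard-fast-lit g14); everything below is PROVED, zero compute.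

Objects. `Ψ^E_h = hubbardTTPrimeSourcedInteraction 1 t' U μ g h` (the pair-sourced `t–t'` interaction,
object E) and its `t''`-pencil `Ψ^M_h(t'') = Ψ^E_h + t''·Φ''(1)` (`hubbardTT'T''SourcedInteraction`, object M;
`Φ''(1) = axialRange2HoppingFermionInteraction 2 1`). Energies are translation-invariant variational
densities `tiGroundEnergyDensity · 2` (range parameter `2`, the range of `Φ''`); for object E this IS the
torus-limit `e_src(t',U,μ,h) = dWaveSourceEnergyDensityTT' t' U μ h` (§1: the sourced `t–t'` terms through
the origin live in `[-1,1]²`, so its mean energy is the same at every `R ≥ 1`, and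
`dWaveSourceEnergyDensityTT'_eq_tiGroundEnergyDensity`).

## Contents

* §1 SUPPORT AND RANGE. `hubbardTTPrimeSourcedInteraction_apply_eq_zero_of_not_subset`,
  `pairSourceInteraction_apply_eq_zero_of_not_subset`; `InfVolFermionState.meanEnergy_hubbardTTPrimeSourced_eq_one`,
  `…_pairSource_eq_one`, `tiGroundEnergyDensity_hubbardTTPrimeSourced_eq_one` (any `R ≥ 1`);
  `dWaveSourceEnergyDensityTT'_eq_tiGroundEnergyDensity_two`.
* §2 OBJECT M WITH A PAIR SOURCE. `hubbardTT'T''SourcedInteraction` (a `t''`-pencil, by definition),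
  `…_tpp_zero` (at `t'' = 0` it is `Ψ^E_h`), `InfVolFermionState.meanEnergy_hubbardTT'T''Sourced`
  (`e(ω) = e^{t,t',t''}(ω) − μρ(ω) − h·e_P(ω)`: it IS `H_M − μN − hΔ_g` per site).
* §3 THE SEAM. `abs_tiGroundEnergyDensity_tppSourced_sub_le_kinematic`: the sourced object-M density is
  `(16/π²)`-Lipschitz in `t''` at EVERY `(t',U,μ,h)` — the CLASS constant (the infimum runs over
  translation-invariant states and `|K₃(σ)| ≤ 16/π²` for every one of them,
  `IsTranslationInvariant.abs_meanEnergy_axialRange2Hopping_le_of_any_density`), not the operator norm `4`;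
  hence **`abs_tiGroundEnergyDensity_tppSourced_sub_dWaveSourceEnergyDensityTT'_le`:
  `|e^M_src(t',t'',U,μ,h) − e_src(t',U,μ,h)| ≤ (16/π²)|t''|`** and the window forms (a certified object-E
  floor / ceiling at source `h` is an object-M floor / ceiling inflated by `(16/π²)|t''|`).
* §4 THE ORDER WORD AVAILABLE TODAY (variational level). **`meanEnergy_pairSource_le_secant_tpp`** (master
  form): for `h > 0` and every translation-invariant state `σ` whose source-free object-M mean energy is within
  `ε` of the object-M minimum, the `d`-pair amplitude obeys
  `e_P(σ) ≤ (e_src(t',U,μ,0) − e_src(t',U,μ,h) + (32/π²)|t''| + ε)/h`; with ONE certified object-E pair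
  `e_src(·,0) ≤ hi₀`, `lo ≤ e_src(·,h)` at the same couplings (`…_le_of_windows_tpp`) or at an ANCHOR
  `(t'₀,U₀,μ₀)` (**`…_le_of_windows_couplings4`**: numerator
  `hi₀ − lo + 8|t' − t'₀| + |U − U₀| + 2|μ − μ₀| + (32/π²)|t''| + ε`, the object-E secant transport of the
  `t'` file composed with the seam); `ε = 0` (`…_of_minimiser_tpp`, `…_of_minimiser_couplings4`): every translation-invariant
  mean-energy minimiser of `H_M − μN` (every translation-invariant ground state of object M at chemical
  potential `μ`), and the ABSENT(`< m₀`) box form `…_lt_of_windows_of_minimiser_near4`. This is the ABSENT-side word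
  «no translation-invariant ground state of object M in the box has `d`-wave pair amplitude `≥ m₀`» read
  off ONE object-E certificate pair, with the model-form residual `(32/π²)·|t''|` in the numerator next to
  the coupling-transport costs `8|Δt'| + |ΔU| + 2|Δμ|` of the `t–t'` files.

HONEST SCOPE: ceiling-side bookkeeping only; nothing here floors `d`-wave order; no number is certified here.
The torus-limit order parameter `m⋆` of object M (Koma–Tasaki's `liminf_h liminf_L`) is NOT defined in the
tree (no pair-sourced `t–t'–t''` torus family); §4 is its variational surrogate (pair amplitudes of
translation-invariant (near-)minimisers at source `0`), which is what an energy-window certificate speaks to.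

## References
* R. B. Israel, *Convexity in the Theory of Lattice Gases* (1979), Thm. I.3.4 (the ground-state energy
  density is `‖·‖`-Lipschitz / concave in the interaction; tangents at minimisers). [cite: Israel1979, Thm. I.3.4]
* O. Bratteli, A. Kishimoto, D. W. Robinson, Commun. Math. Phys. 64 (1978) 41, Thm. 2 (translation-invariant
  ground states minimise the mean energy). [cite: BratteliKishimotoRobinson1978, Thm. 2]
* T. Koma, H. Tasaki, J. Stat. Phys. 76 (1994) 745–803, §1 (response from energy differences in the source).
  [cite: KomaTasaki1994, §1]
* R. B. Griffiths, J. Math. Phys. 5 (1964) 1215 / Phys. Rev. 152 (1966) 240, §II (Griffiths' inequality for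
  derivatives of concave free energies). [cite: Griffiths1966, §II]
* E. Pavarini, I. Dasgupta, T. Saha-Dasgupta, O. Jepsen, O. K. Andersen, Phys. Rev. Lett. 87 (2001) 047003,
  eq. (1) (the one-band `t, t', t''` model of the cuprates). [cite: PavariniEtAl2001, eq. (1)]
-/

noncomputable section

namespace Literature.MathematicalPhysics.QuantumLattice

open _root_.Matrix Finset HubbardWave0 Literature.Probability.LatticeModels ThermodynamicLimit _root_.Filter
open scoped ComplexOrder BigOperators

/-! ### §1 Support and range of the pair-sourced `t–t'` interaction -/

section SupportRange

/-- A finite set through the origin that is NOT inside `[-1,1]²` is neither a singleton nor a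
nearest-neighbour bond `{x, x + e_i}`. [folklore] -/
private theorem ne_singleton_ne_pair_of_not_subset {X : Finset (Site 2)} (h0 : (0 : Site 2) ∈ X)
    (hX : ¬ X ⊆ thicken ({0} : Finset (Site 2)) 1) :
    (∀ x : Site 2, X ≠ {x}) ∧ ∀ (x : Site 2) (i : Fin 2), X ≠ {x, x + unitVec i} := by
  refine ⟨fun x hx => hX ?_, fun x i hx => hX ?_⟩
  · rw [hx] at h0 ⊢
    rw [mem_singleton] at h0
    rw [← h0]
    exact singleton_subset_iff.2 (zero_mem_thicken_zero 1)
  · rw [hx] at h0 ⊢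
    rcases mem_insert.1 h0 with h | h
    · rw [← h]
      exact pair_unitVec_subset_thicken_one i
    · rw [mem_singleton] at h
      rw [eq_neg_of_add_eq_zero_left h.symm]
      exact pair_neg_unitVec_subset_thicken_one i

/-- **Support of the pair-source terms through the origin**: a term `P_g X ≠ 0` with `0 ∈ X` has
`X ⊆ [-1,1]²` (on-site pairs and nearest-neighbour bonds). [cite: KomaTasaki1994, §1] -/
theorem pairSourceInteraction_apply_eq_zero_of_not_subset (g : Site 2 → ℝ) {X : Finset (Site 2)}
    (h0 : (0 : Site 2) ∈ X) (hX : ¬ X ⊆ thicken ({0} : Finset (Site 2)) 1) :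
    (pairSourceInteraction g).Φ X = 0 :=
  pairSourceInteraction_apply_eq_zero g (ne_singleton_ne_pair_of_not_subset h0 hX).1
    (ne_singleton_ne_pair_of_not_subset h0 hX).2

/-- **Support of the pair-sourced `t–t'` terms through the origin**: a term of
`Φ(t,t',U) − μn − hP_g` at `X ∋ 0` vanishes unless `X ⊆ [-1,1]²` (singletons, nearest-neighbour and
diagonal bonds). [cite: KomaTasaki1994, §1] -/
theorem hubbardTTPrimeSourcedInteraction_apply_eq_zero_of_not_subset (t t' U μ : ℝ) (g : Site 2 → ℝ)
    (h : ℝ) {X : Finset (Site 2)} (h0 : (0 : Site 2) ∈ X) (hX : ¬ X ⊆ thicken ({0} : Finset (Site 2)) 1) :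
    (hubbardTTPrimeSourcedInteraction t t' U μ g h).Φ X = 0 := by
  rw [hubbardTTPrimeSourcedInteraction_apply, hubbardTTPrimeMuInteraction_apply,
    hubbardTTPrimeFermionInteraction_apply_eq_zero_of_not_subset t t' U h0 hX,
    numberInteraction_apply_eq_zero (ne_singleton_ne_pair_of_not_subset h0 hX).1,
    pairSourceInteraction_apply_eq_zero_of_not_subset g h0 hX]
  simp

/-- **The sourced mean energy is the same at every range parameter `R ≥ 1`** (every state).
[cite: BratteliKishimotoRobinson1978, §3 (mean energy functional)] -/
theorem InfVolFermionState.meanEnergy_hubbardTTPrimeSourced_eq_one (ω : InfVolFermionState 2)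
    (t t' U μ : ℝ) (g : Site 2 → ℝ) (h : ℝ) {R : ℝ} (hR : 1 ≤ R) :
    ω.meanEnergy (hubbardTTPrimeSourcedInteraction t t' U μ g h) R =
      ω.meanEnergy (hubbardTTPrimeSourcedInteraction t t' U μ g h) 1 :=
  ω.meanEnergy_eq_of_le _ hR fun _ h0 hX =>
    hubbardTTPrimeSourcedInteraction_apply_eq_zero_of_not_subset t t' U μ g h h0 hX

/-- **The pair amplitude `e_P(ω)` is the same at every range parameter `R ≥ 1`** (every state).
[cite: BratteliKishimotoRobinson1978, §3 (mean energy functional)] -/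
theorem InfVolFermionState.meanEnergy_pairSource_eq_one (ω : InfVolFermionState 2) (g : Site 2 → ℝ)
    {R : ℝ} (hR : 1 ≤ R) :
    ω.meanEnergy (pairSourceInteraction g) R = ω.meanEnergy (pairSourceInteraction g) 1 :=
  ω.meanEnergy_eq_of_le _ hR fun _ h0 hX => pairSourceInteraction_apply_eq_zero_of_not_subset g h0 hX

/-- **The sourced variational density is the same at every `R ≥ 1`.**
[cite: BratteliKishimotoRobinson1978, Thm. 2] -/
theorem tiGroundEnergyDensity_hubbardTTPrimeSourced_eq_one (t t' U μ : ℝ) (g : Site 2 → ℝ) (h : ℝ)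
    {R : ℝ} (hR : 1 ≤ R) :
    (hubbardTTPrimeSourcedInteraction t t' U μ g h).tiGroundEnergyDensity R =
      (hubbardTTPrimeSourcedInteraction t t' U μ g h).tiGroundEnergyDensity 1 :=
  FermionInteraction.infMeanEnergyOn_eq_of_le _ _ hR fun _ h0 hX =>
    hubbardTTPrimeSourcedInteraction_apply_eq_zero_of_not_subset t t' U μ g h h0 hX

/-- **`e_src(t',U,μ,h)` at range parameter `2`**: the torus-limit sourced energy density is the
translation-invariant variational density of the pair-sourced `t–t'` interaction also at `R = 2` (the
range at which the `t''`-pencil lives). [cite: BratteliKishimotoRobinson1978, Thm. 2] -/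
theorem dWaveSourceEnergyDensityTT'_eq_tiGroundEnergyDensity_two (t' U μ h : ℝ) :
    dWaveSourceEnergyDensityTT' t' U μ h =
      (hubbardTTPrimeSourcedInteraction 1 t' U μ dWaveFormFactor h).tiGroundEnergyDensity 2 := by
  rw [dWaveSourceEnergyDensityTT'_eq_tiGroundEnergyDensity,
    tiGroundEnergyDensity_hubbardTTPrimeSourced_eq_one 1 t' U μ dWaveFormFactor h (by norm_num : (1 : ℝ) ≤ 2)]

end SupportRange

/-! ### §2 Object M with a pair source: the `t''`-pencil of the pair-sourced `t–t'` interaction -/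

section ObjectM

/-- **The pair-sourced `t–t'–t''` interaction** `Φ(t,t',U) − μn − hP_g + t''·Φ''(1)`: by DEFINITION the
`t''`-pencil of the pair-sourced `t–t'` interaction with the unit axial range-2 hopping (object M of a
one-band material box with Koma–Tasaki's pair field). [cite: PavariniEtAl2001, eq. (1)] -/
def hubbardTT'T''SourcedInteraction (t t' t'' U μ : ℝ) (g : Site 2 → ℝ) (h : ℝ) : FermionInteraction 2 :=
  FermionInteraction.pencil (hubbardTTPrimeSourcedInteraction t t' U μ g h)
    (axialRange2HoppingFermionInteraction 2 1) t''

variable (t t' t'' U μ : ℝ) (g : Site 2 → ℝ) (h : ℝ)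

/-- Two interactions with the same terms are equal. [folklore] -/
private theorem FermionInteraction.ext_of_apply' {d : ℕ} {Ψ Ψ' : FermionInteraction d}
    (hΨ : ∀ X, Ψ.Φ X = Ψ'.Φ X) : Ψ = Ψ' := by
  cases Ψ; cases Ψ'
  exact congrArg FermionInteraction.mk (funext hΨ)

/-- **At `t'' = 0` object M is object E**: `Ψ^M_h(0) = Ψ^E_h`. [cite: PavariniEtAl2001, eq. (1)] -/
theorem hubbardTT'T''SourcedInteraction_tpp_zero :
    hubbardTT'T''SourcedInteraction t t' 0 U μ g h = hubbardTTPrimeSourcedInteraction t t' U μ g h :=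
  FermionInteraction.ext_of_apply' fun X => FermionInteraction.pencil_zero_apply _ _ X

/-- **The mean energy of sourced object M**: `e(ω) = e^{t,t',t''}(ω) − μρ(ω) − h·e_P(ω)` at range
parameter `2` — per site it IS `H(t,t',t'',U) − μN − h(Δ_g + Δ_g†)`. [cite: KomaTasaki1994, §1] -/
theorem InfVolFermionState.meanEnergy_hubbardTT'T''Sourced (ω : InfVolFermionState 2) :
    ω.meanEnergy (hubbardTT'T''SourcedInteraction t t' t'' U μ g h) 2 =
      ω.meanEnergy (hubbardTT'T''FermionInteraction t t' t'' U) 2 - μ * ω.density -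
        h * ω.meanEnergy (pairSourceInteraction g) 1 := by
  rw [hubbardTT'T''SourcedInteraction, hubbardTT'T''FermionInteraction, ω.meanEnergy_pencil,
    ω.meanEnergy_pencil, ω.meanEnergy_hubbardTTPrimeSourced_eq_one t t' U μ g h (by norm_num : (1 : ℝ) ≤ 2),
    meanEnergy_hubbardTTPrimeSourced, ω.meanEnergy_hubbardTTPrime_eq_one t t' U (by norm_num : (1 : ℝ) ≤ 2)]
  ring

/-- **Affinity in the source at fixed `t''`**: `e^M_h(ω) = e^M_0(ω) − h·e_P(ω)`. [cite: KomaTasaki1994, §1] -/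
theorem InfVolFermionState.meanEnergy_hubbardTT'T''Sourced_eq_zero_sub (ω : InfVolFermionState 2) :
    ω.meanEnergy (hubbardTT'T''SourcedInteraction t t' t'' U μ g h) 2 =
      ω.meanEnergy (hubbardTT'T''SourcedInteraction t t' t'' U μ g 0) 2 -
        h * ω.meanEnergy (pairSourceInteraction g) 1 := by
  rw [ω.meanEnergy_hubbardTT'T''Sourced, ω.meanEnergy_hubbardTT'T''Sourced]
  ring

/-- **Concavity in `t''`** of the sourced object-M density (at every source). [cite: Israel1979, Thm. I.3.4] -/
theorem concaveOn_tiGroundEnergyDensity_tppSourced :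
    ConcaveOn ℝ Set.univ fun t'' : ℝ =>
      (hubbardTT'T''SourcedInteraction t t' t'' U μ g h).tiGroundEnergyDensity 2 :=
  FermionInteraction.concaveOn_tiGroundEnergyDensity_pencil _ _ 2

end ObjectM

/-! ### §3 The seam: the sourced object-M density is `(16/π²)`-Lipschitz in `t''` at every source -/

section Seam

variable (t t' U μ : ℝ) (g : Site 2 → ℝ) (h : ℝ)

/-- **`(16/π²)`-Lipschitz in `t''` at every `(t',U,μ,h)`** — the class constant: the infimum runs over
translation-invariant states, and `|K₃(σ)| ≤ 16/π²` for every one of them (doubling pull-back of the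
nearest-neighbour row). [cite: Israel1979, Thm. I.3.4] -/
theorem abs_tiGroundEnergyDensity_tppSourced_sub_le_kinematic (t'' s'' : ℝ) :
    |(hubbardTT'T''SourcedInteraction t t' t'' U μ g h).tiGroundEnergyDensity 2 -
        (hubbardTT'T''SourcedInteraction t t' s'' U μ g h).tiGroundEnergyDensity 2| ≤
      16 / Real.pi ^ 2 * |t'' - s''| :=
  FermionInteraction.abs_infMeanEnergyOn_pencil_sub_le _ _ 2
    (S := {σ : InfVolFermionState 2 | σ.IsTranslationInvariant})
    ⟨_, InfVolFermionState.vacuumState_isTranslationInvariant (d := 2)⟩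
    (fun _ hσ =>
      InfVolFermionState.IsTranslationInvariant.abs_meanEnergy_axialRange2Hopping_le_of_any_density hσ)
    t'' s''

/-- **THE SEAM at every source**: `|e^M_src(t',t'',U,μ,h) − e_src(t',U,μ,h)| ≤ (16/π²)|t''|` — dropping
`t''` (object M → object E) moves the pair-sourced energy density by at most `(16/π²)|t''|`, uniformly in
the source `h`. [cite: Israel1979, Thm. I.3.4] -/
theorem abs_tiGroundEnergyDensity_tppSourced_sub_dWaveSourceEnergyDensityTT'_le (t' U μ h t'' : ℝ) :
    |(hubbardTT'T''SourcedInteraction 1 t' t'' U μ dWaveFormFactor h).tiGroundEnergyDensity 2 -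
        dWaveSourceEnergyDensityTT' t' U μ h| ≤ 16 / Real.pi ^ 2 * |t''| := by
  have hk := abs_tiGroundEnergyDensity_tppSourced_sub_le_kinematic 1 t' U μ dWaveFormFactor h t'' 0
  rwa [hubbardTT'T''SourcedInteraction_tpp_zero, ← dWaveSourceEnergyDensityTT'_eq_tiGroundEnergyDensity_two,
    sub_zero] at hk

/-- **Window transport, FLOOR**: a certified object-E floor `lo ≤ e_src(t',U,μ,h)` is the object-M floor
`lo − (16/π²)|t''| ≤ e^M_src(t',t'',U,μ,h)`. [cite: Israel1979, Thm. I.3.4] -/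
theorem tiGroundEnergyDensity_tppSourced_ge_of_le {t' U μ h lo : ℝ}
    (hlo : lo ≤ dWaveSourceEnergyDensityTT' t' U μ h) (t'' : ℝ) :
    lo - 16 / Real.pi ^ 2 * |t''| ≤
      (hubbardTT'T''SourcedInteraction 1 t' t'' U μ dWaveFormFactor h).tiGroundEnergyDensity 2 := by
  have hk := abs_sub_le_iff.1
    (abs_tiGroundEnergyDensity_tppSourced_sub_dWaveSourceEnergyDensityTT'_le t' U μ h t'')
  linarith [hk.2]

/-- **Window transport, CEILING**: a certified object-E ceiling `e_src(t',U,μ,h) ≤ hi` is the object-M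
ceiling `e^M_src(t',t'',U,μ,h) ≤ hi + (16/π²)|t''|`. [cite: Israel1979, Thm. I.3.4] -/
theorem tiGroundEnergyDensity_tppSourced_le_of_le {t' U μ h hi : ℝ}
    (hhi : dWaveSourceEnergyDensityTT' t' U μ h ≤ hi) (t'' : ℝ) :
    (hubbardTT'T''SourcedInteraction 1 t' t'' U μ dWaveFormFactor h).tiGroundEnergyDensity 2 ≤
      hi + 16 / Real.pi ^ 2 * |t''| := by
  have hk := abs_sub_le_iff.1
    (abs_tiGroundEnergyDensity_tppSourced_sub_dWaveSourceEnergyDensityTT'_le t' U μ h t'')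
  linarith [hk.1]

end Seam

/-! ### §4 The order word available today: a variational ceiling on the pair amplitude of object M -/

section OrderWord

/-- **CEILING ON THE `g = d` PAIR AMPLITUDE OF OBJECT M FROM THE OBJECT-E SECANT** (variational level,
near-minimisers; the master form): for `h > 0`, every translation-invariant state `σ` whose source-FREE
object-M mean energy is within `ε` of the object-M minimum has
`e_P(σ) ≤ (e_src(t',U,μ,0) − e_src(t',U,μ,h) + (32/π²)|t''| + ε)/h`
(`e_P(σ) = σ.meanEnergy (pairSourceInteraction d) 1`, the `d`-wave pair amplitude of §8 of
`TIGroundEnergyDensityResponse`). Proof: the seam (§3) at the sources `0` and `h`, the variational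
principle at `h`, and affinity of the mean energy in `h`. [cite: KomaTasaki1994, §1] -/
theorem meanEnergy_pairSource_le_secant_tpp (t' U μ t'' : ℝ) {h ε : ℝ} (hh : 0 < h)
    {σ : InfVolFermionState 2} (hσ : σ.IsTranslationInvariant)
    (hε : σ.meanEnergy (hubbardTT'T''SourcedInteraction 1 t' t'' U μ dWaveFormFactor 0) 2 ≤
      (hubbardTT'T''SourcedInteraction 1 t' t'' U μ dWaveFormFactor 0).tiGroundEnergyDensity 2 + ε) :
    σ.meanEnergy (pairSourceInteraction dWaveFormFactor) 1 ≤
      (dWaveSourceEnergyDensityTT' t' U μ 0 - dWaveSourceEnergyDensityTT' t' U μ h +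
        32 / Real.pi ^ 2 * |t''| + ε) / h := by
  have h0 := tiGroundEnergyDensity_tppSourced_le_of_le (le_refl (dWaveSourceEnergyDensityTT' t' U μ 0)) t''
  have h1 := tiGroundEnergyDensity_tppSourced_ge_of_le (le_refl (dWaveSourceEnergyDensityTT' t' U μ h)) t''
  have hvar :=
    (hubbardTT'T''SourcedInteraction 1 t' t'' U μ dWaveFormFactor h).tiGroundEnergyDensity_le_meanEnergy 2 hσ
  have haff := σ.meanEnergy_hubbardTT'T''Sourced_eq_zero_sub 1 t' t'' U μ dWaveFormFactor h
  rw [le_div_iff₀ hh]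
  have h32 : 32 / Real.pi ^ 2 * |t''| = 2 * (16 / Real.pi ^ 2 * |t''|) := by ring
  rw [h32]
  nlinarith [h0, h1, hvar, haff, hε]

/-- **… FROM ONE CERTIFIED OBJECT-E PAIR** at the same couplings: `e_src(t',U,μ,0) ≤ hi₀` and
`lo ≤ e_src(t',U,μ,h)` (`h > 0`) give `e_P(σ) ≤ (hi₀ − lo + (32/π²)|t''| + ε)/h` for every
translation-invariant `ε`-near-minimiser `σ` of source-free object M. [cite: KomaTasaki1994, §1] -/
theorem meanEnergy_pairSource_le_of_windows_tpp {t' U μ h hi₀ lo ε : ℝ} (t'' : ℝ) (hh : 0 < h)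
    (hhi : dWaveSourceEnergyDensityTT' t' U μ 0 ≤ hi₀) (hlo : lo ≤ dWaveSourceEnergyDensityTT' t' U μ h)
    {σ : InfVolFermionState 2} (hσ : σ.IsTranslationInvariant)
    (hε : σ.meanEnergy (hubbardTT'T''SourcedInteraction 1 t' t'' U μ dWaveFormFactor 0) 2 ≤
      (hubbardTT'T''SourcedInteraction 1 t' t'' U μ dWaveFormFactor 0).tiGroundEnergyDensity 2 + ε) :
    σ.meanEnergy (pairSourceInteraction dWaveFormFactor) 1 ≤
      (hi₀ - lo + 32 / Real.pi ^ 2 * |t''| + ε) / h :=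
  (meanEnergy_pairSource_le_secant_tpp t' U μ t'' hh hσ hε).trans
    (div_le_div_of_nonneg_right (by linarith) hh.le)

/-- **THE BOX FORM IN ALL FOUR COUPLINGS `(t', U, μ ; t'')`**: ONE certified object-E pair at the ANCHOR
`(t'₀, U₀, μ₀)` — `e_src(t'₀,U₀,μ₀,0) ≤ hi₀`, `lo ≤ e_src(t'₀,U₀,μ₀,h)`, `h > 0` — bounds the `d`-wave pair
amplitude of every translation-invariant `ε`-near-minimiser of source-free object M at ANY `(t', t'', U, μ)`:
`e_P(σ) ≤ (hi₀ − lo + 8|t' − t'₀| + |U − U₀| + 2|μ − μ₀| + (32/π²)|t''| + ε)/h` (the `(t',U,μ)` costs are the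
object-E secant transport of `DWaveSourceEnergyDensityTPrimeTransport` §3 /
`DWaveOrderParameterSemicontinuity` §Transport; the `t''` cost is the seam §3). [cite: Israel1979, Thm. I.3.4] -/
theorem meanEnergy_pairSource_le_of_windows_couplings4 {t'₀ U₀ μ₀ h hi₀ lo ε : ℝ} (hh : 0 < h)
    (hhi : dWaveSourceEnergyDensityTT' t'₀ U₀ μ₀ 0 ≤ hi₀) (hlo : lo ≤ dWaveSourceEnergyDensityTT' t'₀ U₀ μ₀ h)
    (t' U μ t'' : ℝ) {σ : InfVolFermionState 2} (hσ : σ.IsTranslationInvariant)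
    (hε : σ.meanEnergy (hubbardTT'T''SourcedInteraction 1 t' t'' U μ dWaveFormFactor 0) 2 ≤
      (hubbardTT'T''SourcedInteraction 1 t' t'' U μ dWaveFormFactor 0).tiGroundEnergyDensity 2 + ε) :
    σ.meanEnergy (pairSourceInteraction dWaveFormFactor) 1 ≤
      (hi₀ - lo + 8 * |t' - t'₀| + |U - U₀| + 2 * |μ - μ₀| + 32 / Real.pi ^ 2 * |t''| + ε) / h := by
  have hmu := secant_dWaveSourceEnergyDensityTT'_sub_mu_le t' U 0 h μ₀ μ
  have hU := secant_dWaveSourceEnergyDensityTT'_sub_U_le t' μ₀ 0 h U₀ U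
  have htp := secant_dWaveSourceEnergyDensityTT'_sub_tp_le U₀ μ₀ 0 h t'₀ t'
  refine (meanEnergy_pairSource_le_secant_tpp t' U μ t'' hh hσ hε).trans
    (div_le_div_of_nonneg_right ?_ hh.le)
  linarith

/-- **`ε = 0`: every translation-invariant mean-energy minimiser of `H_M − μN`** (every translation-invariant
ground state of object M at chemical potential `μ`, source off) has `d`-wave pair amplitude
`e_P(σ) ≤ (hi₀ − lo + (32/π²)|t''|)/h` — the ABSENT-side word for object M read off one object-E pair at
the same `(t',U,μ)`. [cite: BratteliKishimotoRobinson1978, Thm. 2] -/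
theorem meanEnergy_pairSource_le_of_windows_of_minimiser_tpp {t' U μ h hi₀ lo : ℝ} (t'' : ℝ)
    (hh : 0 < h) (hhi : dWaveSourceEnergyDensityTT' t' U μ 0 ≤ hi₀)
    (hlo : lo ≤ dWaveSourceEnergyDensityTT' t' U μ h) {σ : InfVolFermionState 2}
    (hmin : σ.IsMeanEnergyMinimiser (hubbardTT'T''SourcedInteraction 1 t' t'' U μ dWaveFormFactor 0) 2) :
    σ.meanEnergy (pairSourceInteraction dWaveFormFactor) 1 ≤ (hi₀ - lo + 32 / Real.pi ^ 2 * |t''|) / h := by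
  have hk := meanEnergy_pairSource_le_of_windows_tpp (ε := 0) t'' hh hhi hlo hmin.1
    (by rw [add_zero]; exact hmin.meanEnergy_eq.le)
  rwa [add_zero] at hk

/-- **`ε = 0`, box form**: every translation-invariant ground state of object M at `(t', t'', U, μ)` has
`e_P(σ) ≤ (hi₀ − lo + 8|t' − t'₀| + |U − U₀| + 2|μ − μ₀| + (32/π²)|t''|)/h` from one object-E pair at the
anchor `(t'₀, U₀, μ₀)`. [cite: BratteliKishimotoRobinson1978, Thm. 2] -/
theorem meanEnergy_pairSource_le_of_windows_of_minimiser_couplings4 {t'₀ U₀ μ₀ h hi₀ lo : ℝ}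
    (hh : 0 < h) (hhi : dWaveSourceEnergyDensityTT' t'₀ U₀ μ₀ 0 ≤ hi₀)
    (hlo : lo ≤ dWaveSourceEnergyDensityTT' t'₀ U₀ μ₀ h) (t' U μ t'' : ℝ) {σ : InfVolFermionState 2}
    (hmin : σ.IsMeanEnergyMinimiser (hubbardTT'T''SourcedInteraction 1 t' t'' U μ dWaveFormFactor 0) 2) :
    σ.meanEnergy (pairSourceInteraction dWaveFormFactor) 1 ≤
      (hi₀ - lo + 8 * |t' - t'₀| + |U - U₀| + 2 * |μ - μ₀| + 32 / Real.pi ^ 2 * |t''|) / h := by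
  have hk := meanEnergy_pairSource_le_of_windows_couplings4 (ε := 0) hh hhi hlo t' U μ t'' hmin.1
    (by rw [add_zero]; exact hmin.meanEnergy_eq.le)
  rwa [add_zero] at hk

/-- **ABSENT(`< m₀`) for object M on an explicit box in `(t', U, μ ; t'')` from one object-E pair**: if
`8|t' − t'₀| + |U − U₀| + 2|μ − μ₀| + (32/π²)|t''| < h·m₀ − (hi₀ − lo)` then no translation-invariant
ground state of object M at `(t', t'', U, μ)` has `d`-wave pair amplitude `≥ m₀`.
[cite: KomaTasaki1994, §1] -/
theorem meanEnergy_pairSource_lt_of_windows_of_minimiser_near4 {t'₀ U₀ μ₀ h hi₀ lo m₀ : ℝ}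
    (hh : 0 < h) (hhi : dWaveSourceEnergyDensityTT' t'₀ U₀ μ₀ 0 ≤ hi₀)
    (hlo : lo ≤ dWaveSourceEnergyDensityTT' t'₀ U₀ μ₀ h) {t' U μ t'' : ℝ}
    (hnear : 8 * |t' - t'₀| + |U - U₀| + 2 * |μ - μ₀| + 32 / Real.pi ^ 2 * |t''| < h * m₀ - (hi₀ - lo))
    {σ : InfVolFermionState 2}
    (hmin : σ.IsMeanEnergyMinimiser (hubbardTT'T''SourcedInteraction 1 t' t'' U μ dWaveFormFactor 0) 2) :
    σ.meanEnergy (pairSourceInteraction dWaveFormFactor) 1 < m₀ := by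
  refine (meanEnergy_pairSource_le_of_windows_of_minimiser_couplings4 hh hhi hlo t' U μ t'' hmin).trans_lt ?_
  rw [div_lt_iff₀ hh]
  linarith [hnear]

end OrderWord

end Literature.MathematicalPhysics.QuantumLattice

end
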